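import Summits.CriticalPhenomena.CardyFormulaZ2.Theorems.CardySelfDualSegmentUniformMarginalityBasePointTransportParam
import Summits.CriticalPhenomena.CardyFormulaZ2.Theorems.CardySelfDualSegmentUniformMarginalityFixedDomainContinuityZero

/-!
# Crux `UniformMarginality` (stmt-CriticalPhenomena-5472), line `Sketch`: the wild-domain half of the crux
# is implied by the route's Target — sheared Cardy limits pass from rectilinear to arbitrary conformal rectangles

Skeleton v8 of the line (`Cruxes/UniformMarginality/Lines/Sketch.lean`) reduces the crux to two kernels about
RECTILINEAR domains: (B₁) the crux on rectilinear conformal rectangles and (B₂) single-parameter crude-crossing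
continuity across rectilinear marked domains `ε₀`-close to a possibly WILD centre. This file proves that the
wild-domain content (B₂) carries no research risk of its own for the ROUTE `CardySelfDualSegment`:

* `cardyLimit_of_rectilinear` (W): at a fixed parameter `t` and modulus `α ∈ ℍ`, if the crude `M_t`-crossing
  probabilities of every RECTILINEAR conformal rectangle `R'` converge to Cardy's value of `φ_α R'`, then so do
  those of EVERY conformal rectangle (`CardyMod t α` restricted to rectilinear test domains implies `CardyMod t α`):
  sandwich `Q' ≤ R' ≤ Q''` by the landed mixed rectilinear approximants with nested crude events
  (`stub_mixedApproximants`, `Pext_mono_of_nested`), shear by `φ_α` (Lipschitz, `dist_moduliShear_le`), and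
  continuity of the Cardy value in the marked domain (`stub_cardyContinuity`, Radó);
* `fixedDomainContinuity_of_cardyMod` (F): `CardyMod t₀ α` ⇒ fixed-parameter domain continuity (B₂a″) at `t₀`
  (the landed `fixedDomainContinuity_zero`, p116559, is the case `t₀ = 0`, `α = ζ`);
* `integratedBoundAt_of_cardyMod` (U): (B₁ at `t₀`) ∧ `CardyMod t₀ α` ⇒ the crux AT `t₀` for every conformal
  rectangle (`integratedBoundAtParam_of_fixedDomainContinuity`, p116916);
* `uniformMarginality_of_rectilinear_of_target` (T): (B₁) → `Target` → `UniformMarginality` (route decls by name).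

So `UniformMarginality = (B₁) ∧ (wild-domain continuity)` with the second conjunct a consequence of the route's own
Target: restating the crux as (B₁) (and the `UniformMarginality` antecedents of `SegmentOpen`/`SegmentClosed`
likewise) loses nothing the route needs; the companion file `…SegmentClosedOfRectilinearMarginality.lean`
re-proves `SegmentClosed` from the weakened antecedent.
-/

noncomputable section

namespace Summit.CriticalPhenomena.CardyFormulaZ2.Cruxes.UniformMarginality.HeatFlow

open Filter Topology Set Metric
open Literature.Probability.Percolation Literature.Probability.LatticeModels
  Literature.Probability.RandomPlanarGeometry
open Literature.Barriers.CriticalPhenomena (shearHomeomorph moduliShear)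
open Summit.CriticalPhenomena.CardyFormulaZ2.Cruxes.SmirnovBasePoint.ShearedSandwich.ShearDictionary
  (dist_moduliShear_eq)
open Summit.CriticalPhenomena.CardyFormulaZ2.Cruxes.LoopsToCrossings.OracleSandwich
  (stub_cardyContinuity)

/-! ## The shear `φ_α` is Lipschitz -/

/-- `‖φ_β w‖ ≤ (1 + ‖β‖) ‖w‖` for Beffara's shear `φ_β (x + iy) = x + β y`. -/
theorem norm_moduliShear_le (β w : ℂ) : ‖moduliShear β w‖ ≤ (1 + ‖β‖) * ‖w‖ := by
  unfold moduliShear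
  calc ‖(w.re : ℂ) + β * (w.im : ℂ)‖ ≤ ‖(w.re : ℂ)‖ + ‖β * (w.im : ℂ)‖ := norm_add_le _ _
    _ = |w.re| + ‖β‖ * |w.im| := by
        rw [norm_mul, Complex.norm_real, Complex.norm_real, Real.norm_eq_abs, Real.norm_eq_abs]
    _ ≤ ‖w‖ + ‖β‖ * ‖w‖ :=
        add_le_add (Complex.abs_re_le_norm w)
          (mul_le_mul_of_nonneg_left (Complex.abs_im_le_norm w) (norm_nonneg β))
    _ = (1 + ‖β‖) * ‖w‖ := by ring

/-- `dist (φ_β a) (φ_β b) ≤ (1 + ‖β‖) · dist a b`. -/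
theorem dist_moduliShear_le (β a b : ℂ) :
    dist (moduliShear β a) (moduliShear β b) ≤ (1 + ‖β‖) * dist a b := by
  rw [dist_moduliShear_eq, dist_eq_norm]
  exact norm_moduliShear_le β (a - b)

/-- Sheared boundary loops: if `Q`, `R` are `ε`-close in boundary loop then `φ_β Q`, `φ_β R`
(`MarkedDomain.map` by `shearHomeomorph β`) are `(1 + ‖β‖) ε`-close. -/
theorem dist_boundary_map_shear_le_mul {β : ℂ} (hβ : β.im ≠ 0) {Q R : ConformalRectangle} {ε : ℝ}
    (hQb : ∀ u : ℝ, dist (Q.boundary u) (R.boundary u) ≤ ε) (u : ℝ) :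
    dist ((Q.map (shearHomeomorph β hβ)).boundary u) ((R.map (shearHomeomorph β hβ)).boundary u)
      ≤ (1 + ‖β‖) * ε :=
  calc dist ((Q.map (shearHomeomorph β hβ)).boundary u) ((R.map (shearHomeomorph β hβ)).boundary u)
      = dist (moduliShear β (Q.boundary u)) (moduliShear β (R.boundary u)) := rfl
    _ ≤ (1 + ‖β‖) * dist (Q.boundary u) (R.boundary u) := dist_moduliShear_le β _ _
    _ ≤ (1 + ‖β‖) * ε := mul_le_mul_of_nonneg_left (hQb u) (by positivity)

/-- If `Q`, `R` are `ε / (1 + ‖β‖)`-close in boundary loop then `φ_β Q`, `φ_β R` are `ε`-close. -/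
theorem dist_boundary_map_shear_le_of_div {β : ℂ} (hβ : β.im ≠ 0) {Q R : ConformalRectangle} {ε : ℝ}
    (hQb : ∀ u : ℝ, dist (Q.boundary u) (R.boundary u) ≤ ε / (1 + ‖β‖)) (u : ℝ) :
    dist ((Q.map (shearHomeomorph β hβ)).boundary u) ((R.map (shearHomeomorph β hβ)).boundary u) ≤ ε := by
  have hL : 0 < 1 + ‖β‖ := by positivity
  have h := dist_boundary_map_shear_le_mul hβ hQb u
  rwa [mul_div_cancel₀ _ hL.ne'] at h

/-- `ε / (1 + ‖β‖) ≤ ε` for `ε ≥ 0`: marks that are `ε / (1 + ‖β‖)`-close are `ε`-close. -/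
theorem div_one_add_norm_le (β : ℂ) {ε : ℝ} (hε : 0 ≤ ε) : ε / (1 + ‖β‖) ≤ ε :=
  div_le_self hε (le_add_of_nonneg_right (norm_nonneg β))

/-! ## (W) Sheared Cardy limits: rectilinear test domains suffice -/

/-- **(W) `CardyMod t α` restricted to rectilinear test domains implies `CardyMod t α`.** Fix a parameter
`t` and a modulus `α` with `im α > 0`. If for every RECTILINEAR conformal rectangle `R'` (boundary covered by
finitely many axis-parallel segments) and every conformal rectangle `R` with the carrier and marked points of
`φ_α R'`, uniformized by `(φ, x)`, the crude `M_t`-crossing probabilities of `R'` tend to `F(crossRatio x)` as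
the mesh `δ → 0⁺`, then the same holds for EVERY conformal rectangle `R'`. Proof: rectilinear approximants
`Q' ≤ R' ≤ Q''` with nested crude events (`stub_mixedApproximants`, `Pext_mono_of_nested`), so
`P_t(Q',δ) ≤ P_t(R',δ) ≤ P_t(Q'',δ)` below a mesh threshold; `φ_α Q'`, `φ_α Q''` are close to `φ_α R'` in loop
and marks (`φ_α` is `(1 + ‖α‖)`-Lipschitz), so their Cardy values are `ε/3`-close to that of `φ_α R'`
(`stub_cardyContinuity`), which is that of `R` (`crossRatio_eq_of_image_data`, same carrier and points). -/
theorem cardyLimit_of_rectilinear :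
    ∀ (t : unitInterval) (α : ℂ), 0 < α.im →
    (∀ (R R' : ConformalRectangle) (φ : Literature.Probability.RandomPlanarGeometry.ConformalEquiv UpperHalfPlane.upperHalfPlaneSet R.carrier)
      (x : Fin 4 → ℝ),
      (∃ S : Finset (ℂ × ℂ), (∀ p ∈ S, p.1.re = p.2.re ∨ p.1.im = p.2.im) ∧
        frontier R'.carrier ⊆ ⋃ p ∈ S, segment ℝ p.1 p.2) →
      R.carrier = Literature.Barriers.CriticalPhenomena.moduliShear α '' R'.carrier →
      (∀ i, R.pt i = Literature.Barriers.CriticalPhenomena.moduliShear α (R'.pt i)) → R.IsUniformizing φ x →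
      Filter.Tendsto (Literature.Probability.Percolation.cornerCrossingProb t R') (nhdsWithin 0 (Set.Ioi 0))
        (nhds (Literature.Probability.RandomPlanarGeometry.cardyFunction (Literature.Probability.RandomPlanarGeometry.crossRatio x)))) →
    ∀ (R R' : ConformalRectangle) (φ : Literature.Probability.RandomPlanarGeometry.ConformalEquiv UpperHalfPlane.upperHalfPlaneSet R.carrier)
      (x : Fin 4 → ℝ),
      R.carrier = Literature.Barriers.CriticalPhenomena.moduliShear α '' R'.carrier →
      (∀ i, R.pt i = Literature.Barriers.CriticalPhenomena.moduliShear α (R'.pt i)) → R.IsUniformizing φ x →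
      Filter.Tendsto (Literature.Probability.Percolation.cornerCrossingProb t R') (nhdsWithin 0 (Set.Ioi 0))
        (nhds (Literature.Probability.RandomPlanarGeometry.cardyFunction (Literature.Probability.RandomPlanarGeometry.crossRatio x))) := by
  intro t α hα hrect R R' φ x hc hp hu
  have hα' : α.im ≠ 0 := hα.ne'
  have hL : 0 < 1 + ‖α‖ := by positivity
  -- the sheared rectangle `φ_α R'` with its own datum has the modulus of `R`
  obtain ⟨φ₀, x₀, hφ₀⟩ := MarkedDomain.exists_isUniformizing_holds (R'.map (shearHomeomorph α hα'))
  have hx : crossRatio x₀ = crossRatio x :=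
    ConformalRectangle.crossRatio_eq_of_image_data (h := id)
      (R := R'.map (shearHomeomorph α hα')) (S := R) differentiableOn_id (injOn_id _)
      continuousOn_id (by rw [image_id, hc]; rfl) (fun i => by rw [hp i]; rfl) hφ₀ hu
  rw [Metric.tendsto_nhds]
  intro ε hε
  have hε3 : 0 < ε / 3 := by positivity
  -- continuity of the Cardy value at `φ_α R'`, accuracy `ε / 3`
  obtain ⟨ε₁, hε₁, hcont⟩ :=
    stub_cardyContinuity (R'.map (shearHomeomorph α hα')) φ₀ x₀ hφ₀ (ε / 3) hε3
  -- rectilinear approximants of `R'` with nested crude events, `ε₁ / (1 + ‖α‖)`-close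
  obtain ⟨Q', Q'', hS', hS'', hb', hm', hb'', hm'', δ₁, hδ₁, hnest⟩ :=
    stub_mixedApproximants R' (ε₁ / (1 + ‖α‖)) (div_pos hε₁ hL)
  -- data of the sheared approximants and closeness of their Cardy values
  obtain ⟨ψ', y', hψ'⟩ := MarkedDomain.exists_isUniformizing_holds (Q'.map (shearHomeomorph α hα'))
  obtain ⟨ψ'', y'', hψ''⟩ := MarkedDomain.exists_isUniformizing_holds (Q''.map (shearHomeomorph α hα'))
  have hmk' : ∀ i : Fin 4,
      |(Q'.map (shearHomeomorph α hα')).mark i - (R'.map (shearHomeomorph α hα')).mark i| ≤ ε₁ :=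
    fun i => (hm' i).trans (div_one_add_norm_le α hε₁.le)
  have hmk'' : ∀ i : Fin 4,
      |(Q''.map (shearHomeomorph α hα')).mark i - (R'.map (shearHomeomorph α hα')).mark i| ≤ ε₁ :=
    fun i => (hm'' i).trans (div_one_add_norm_le α hε₁.le)
  have hF' : |Literature.Probability.RandomPlanarGeometry.cardyFunction (crossRatio y') -
      Literature.Probability.RandomPlanarGeometry.cardyFunction (crossRatio x₀)| ≤ ε / 3 :=
    hcont _ (dist_boundary_map_shear_le_of_div hα' hb') hmk' ψ' y' hψ'
  have hF'' : |Literature.Probability.RandomPlanarGeometry.cardyFunction (crossRatio y'') -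
      Literature.Probability.RandomPlanarGeometry.cardyFunction (crossRatio x₀)| ≤ ε / 3 :=
    hcont _ (dist_boundary_map_shear_le_of_div hα' hb'') hmk'' ψ'' y'' hψ''
  -- Cardy limits at the rectilinear approximants
  have hlim' : Tendsto (cornerCrossingProb t Q') (𝓝[>] 0)
      (𝓝 (Literature.Probability.RandomPlanarGeometry.cardyFunction (crossRatio y'))) :=
    hrect _ Q' ψ' y' hS' rfl (fun _ => rfl) hψ'
  have hlim'' : Tendsto (cornerCrossingProb t Q'') (𝓝[>] 0)
      (𝓝 (Literature.Probability.RandomPlanarGeometry.cardyFunction (crossRatio y''))) :=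
    hrect _ Q'' ψ'' y'' hS'' rfl (fun _ => rfl) hψ''
  obtain ⟨δ', hδ', h'⟩ := exists_threshold_of_tendsto_nhdsGT hlim' hε3
  obtain ⟨δ'', hδ'', h''⟩ := exists_threshold_of_tendsto_nhdsGT hlim'' hε3
  -- below all three thresholds
  have hpos : (0 : ℝ) < min δ₁ (min δ' δ'') := lt_min hδ₁ (lt_min hδ' hδ'')
  filter_upwards [Ioo_mem_nhdsGT hpos] with δ hδI
  obtain ⟨hδ, hδlt⟩ := hδI
  have hδ₁' : δ < δ₁ := hδlt.trans_le (min_le_left _ _)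
  have hδ'lt : δ < δ' := hδlt.trans_le ((min_le_right _ _).trans (min_le_left _ _))
  have hδ''lt : δ < δ'' := hδlt.trans_le ((min_le_right _ _).trans (min_le_right _ _))
  -- nesting of the crude crossing probabilities at the parameter `t`
  have hlo : Pext Q' δ t ≤ Pext R' δ t :=
    Pext_mono_of_nested (fun ω hω hωc => (hnest δ hδ hδ₁' ω hω).1 hωc) t
  have hhi : Pext R' δ t ≤ Pext Q'' δ t :=
    Pext_mono_of_nested (fun ω hω hωc => (hnest δ hδ hδ₁' ω hω).2 hωc) t
  rw [Pext_coe, Pext_coe] at hlo hhi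
  have h1 := h' δ hδ hδ'lt
  have h2 := h'' δ hδ hδ''lt
  rw [← hx, Real.dist_eq, abs_lt]
  rw [abs_lt] at h1 h2
  rw [abs_le] at hF' hF''
  constructor <;> linarith [hF'.1, hF'.2, hF''.1, hF''.2, h1.1, h1.2, h2.1, h2.2]

/-! ## (F) Fixed-parameter domain continuity from `CardyMod t₀ α` -/

/-- **(F) Fixed-parameter domain continuity at every point of `G`** (the kernel (B₂a″) of skeleton v6 at
`t₀`, from sheared Cardy limits at `t₀`; `fixedDomainContinuity_zero` is the case `t₀ = 0`, `α = ζ`): if for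
the modulus `α ∈ ℍ` the crude `M_{t₀}`-crossing probabilities of every conformal rectangle `R'` converge to the
Cardy value of `φ_α R'`, then for every conformal rectangle `R` and `ε > 0` there is `ε₀ > 0` such that every
(rectilinear) conformal rectangle `Q`, `ε₀`-close to `R` in boundary loop and marks, has a mesh threshold
`δ₀ > 0` with `|P_{t₀}(Q,δ) − P_{t₀}(R,δ)| ≤ ε` for `0 < δ < δ₀`. The rectilinearity of `Q` is not used. -/
theorem fixedDomainContinuity_of_cardyMod :
    ∀ (t₀ : unitInterval) (α : ℂ), 0 < α.im →
    (∀ (R R' : ConformalRectangle) (φ : Literature.Probability.RandomPlanarGeometry.ConformalEquiv UpperHalfPlane.upperHalfPlaneSet R.carrier)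
      (x : Fin 4 → ℝ),
      R.carrier = Literature.Barriers.CriticalPhenomena.moduliShear α '' R'.carrier →
      (∀ i, R.pt i = Literature.Barriers.CriticalPhenomena.moduliShear α (R'.pt i)) → R.IsUniformizing φ x →
      Filter.Tendsto (Literature.Probability.Percolation.cornerCrossingProb t₀ R') (nhdsWithin 0 (Set.Ioi 0))
        (nhds (Literature.Probability.RandomPlanarGeometry.cardyFunction (Literature.Probability.RandomPlanarGeometry.crossRatio x)))) →
    ∀ (R : ConformalRectangle) (ε : ℝ), 0 < ε → ∃ ε₀ > 0, ∀ Q : ConformalRectangle,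
      (∃ S : Finset (ℂ × ℂ), (∀ p ∈ S, p.1.re = p.2.re ∨ p.1.im = p.2.im) ∧
        frontier Q.carrier ⊆ ⋃ p ∈ S, segment ℝ p.1 p.2) →
      (∀ u : ℝ, dist (Q.boundary u) (R.boundary u) ≤ ε₀) → (∀ i : Fin 4, |Q.mark i - R.mark i| ≤ ε₀) →
      ∃ δ₀ > 0, ∀ δ : ℝ, 0 < δ → δ < δ₀ → |Pext Q δ t₀ - Pext R δ t₀| ≤ ε := by
  intro t₀ α hα hC R ε hε
  have hα' : α.im ≠ 0 := hα.ne'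
  have hL : 0 < 1 + ‖α‖ := by positivity
  -- the sheared rectangle `φ_α R`, a uniformizing datum and its Cardy value
  obtain ⟨φ, x, hφ⟩ := MarkedDomain.exists_isUniformizing_holds (R.map (shearHomeomorph α hα'))
  -- continuity of the Cardy value at `φ_α R`, accuracy `ε / 3`
  obtain ⟨ε₁, hε₁, hcont⟩ :=
    stub_cardyContinuity (R.map (shearHomeomorph α hα')) φ x hφ (ε / 3) (by positivity)
  refine ⟨ε₁ / (1 + ‖α‖), div_pos hε₁ hL, fun Q _hQ hQb hQm => ?_⟩
  -- a uniformizing datum of `φ_α Q`; the Cardy values are `ε/3`-close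
  obtain ⟨ψ, y, hψ⟩ := MarkedDomain.exists_isUniformizing_holds (Q.map (shearHomeomorph α hα'))
  have hm : ∀ i : Fin 4,
      |(Q.map (shearHomeomorph α hα')).mark i - (R.map (shearHomeomorph α hα')).mark i| ≤ ε₁ :=
    fun i => (hQm i).trans (div_one_add_norm_le α hε₁.le)
  have hF : |Literature.Probability.RandomPlanarGeometry.cardyFunction (crossRatio y) -
      Literature.Probability.RandomPlanarGeometry.cardyFunction (crossRatio x)| ≤ ε / 3 :=
    hcont _ (dist_boundary_map_shear_le_of_div hα' hQb) hm ψ y hψ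
  -- mesh thresholds for `Q` and for `R` at accuracy `ε / 3`
  obtain ⟨δQ, hδQ, hQlim⟩ := exists_threshold_of_tendsto_nhdsGT
    (hC _ Q ψ y rfl (fun _ => rfl) hψ) (e := ε / 3) (by positivity)
  obtain ⟨δR, hδR, hRlim⟩ := exists_threshold_of_tendsto_nhdsGT
    (hC _ R φ x rfl (fun _ => rfl) hφ) (e := ε / 3) (by positivity)
  refine ⟨min δQ δR, lt_min hδQ hδR, fun δ hδ hδδ₀ => ?_⟩
  have h1 := hQlim δ hδ (lt_of_lt_of_le hδδ₀ (min_le_left _ _))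
  have h2 := hRlim δ hδ (lt_of_lt_of_le hδδ₀ (min_le_right _ _))
  rw [Pext_coe, Pext_coe]
  rw [abs_lt] at h1 h2
  rw [abs_le] at hF ⊢
  constructor <;> linarith [hF.1, hF.2, h1.1, h1.2, h2.1, h2.2]

/-! ## (U) The crux at a point of `G` from the crux on rectilinear domains -/

/-- **(U) Marginality at `t₀ ∈ G` for EVERY conformal rectangle from marginality on rectilinear ones.** If
(B₁ at `t₀`) every rectilinear conformal rectangle has a modulus of continuity of `t ↦ P_t(·,δ)` at `t₀` uniform
in the mesh, and `t₀ ∈ G` (sheared Cardy limits `CardyMod t₀ α` for some `α ∈ ℍ`), then every conformal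
rectangle has such a modulus at `t₀` ((F) + the landed one-parameter transport
`integratedBoundAtParam_of_fixedDomainContinuity`). -/
theorem integratedBoundAt_of_cardyMod :
    ∀ (t₀ : unitInterval) (α : ℂ), 0 < α.im →
    (∀ (R R' : ConformalRectangle) (φ : Literature.Probability.RandomPlanarGeometry.ConformalEquiv UpperHalfPlane.upperHalfPlaneSet R.carrier)
      (x : Fin 4 → ℝ),
      R.carrier = Literature.Barriers.CriticalPhenomena.moduliShear α '' R'.carrier →
      (∀ i, R.pt i = Literature.Barriers.CriticalPhenomena.moduliShear α (R'.pt i)) → R.IsUniformizing φ x →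
      Filter.Tendsto (Literature.Probability.Percolation.cornerCrossingProb t₀ R') (nhdsWithin 0 (Set.Ioi 0))
        (nhds (Literature.Probability.RandomPlanarGeometry.cardyFunction (Literature.Probability.RandomPlanarGeometry.crossRatio x)))) →
    (∀ R : ConformalRectangle,
      (∃ S : Finset (ℂ × ℂ), (∀ p ∈ S, p.1.re = p.2.re ∨ p.1.im = p.2.im) ∧
        frontier R.carrier ⊆ ⋃ p ∈ S, segment ℝ p.1 p.2) →
      ∀ ε > 0, ∃ η > 0, ∀ δ : ℝ, 0 < δ → ∀ t ∈ Set.Icc (0 : ℝ) 1, |t - t₀| < η →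
        |Pext R δ t - Pext R δ t₀| < ε) →
    ∀ R : ConformalRectangle, ∀ ε > 0, ∃ η > 0, ∀ δ : ℝ, 0 < δ → ∀ t ∈ Set.Icc (0 : ℝ) 1,
      |t - t₀| < η → |Pext R δ t - Pext R δ t₀| < ε :=
  fun t₀ _α hα hC hB₁ => integratedBoundAtParam_of_fixedDomainContinuity (t₀ : ℝ) t₀.2
    (fixedDomainContinuity_of_cardyMod t₀ _ hα hC) hB₁

/-! ## (T) The crux from the crux on rectilinear domains and the route's Target -/

/-- **(T) `UniformMarginality` from (B₁) and the route's `Target`.** The crux for arbitrary conformal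
rectangles follows from (B₁) the crux on rectilinear conformal rectangles together with the route's Target
(`∀ t, ∃ α ∈ ℍ, CardyMod t α`): the wild-domain half of the crux is a consequence of what the route sets out to
prove, pointwise in the parameter ((U) at every `t₀`, read through `Pext R δ t = P t R δ`). Hence weakening the
route item to (B₁) loses nothing. -/
theorem uniformMarginality_of_rectilinear_of_target :
    (∀ R : ConformalRectangle,
      (∃ S : Finset (ℂ × ℂ), (∀ p ∈ S, p.1.re = p.2.re ∨ p.1.im = p.2.im) ∧
        frontier R.carrier ⊆ ⋃ p ∈ S, segment ℝ p.1 p.2) →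
      ∀ t₀ : ℝ, t₀ ∈ Set.Icc (0 : ℝ) 1 → ∀ ε > 0, ∃ η > 0,
        ∀ δ : ℝ, 0 < δ → ∀ t ∈ Set.Icc (0 : ℝ) 1, |t - t₀| < η → |Pext R δ t - Pext R δ t₀| < ε) →
    Summit.CriticalPhenomena.CardyFormulaZ2.Theses.CardySelfDualSegment.Target →
    Summit.CriticalPhenomena.CardyFormulaZ2.Theses.CardySelfDualSegment.UniformMarginality := by
  intro hB₁ hT
  -- the route's Target, over the tree's `cornerCrossingProb` (literally the route's `P`)
  have hT' : ∀ t : unitInterval, ∃ α : ℂ, 0 < α.im ∧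
      ∀ (R R' : ConformalRectangle) (φ : ConformalEquiv UpperHalfPlane.upperHalfPlaneSet R.carrier)
        (x : Fin 4 → ℝ),
        R.carrier = moduliShear α '' R'.carrier → (∀ i, R.pt i = moduliShear α (R'.pt i)) →
        R.IsUniformizing φ x →
        Tendsto (cornerCrossingProb t R') (𝓝[>] 0)
          (𝓝 (Literature.Probability.RandomPlanarGeometry.cardyFunction (crossRatio x))) := hT
  refine uniformMarginality_of_integratedBound fun R t₀ ht₀ ε hε => ?_
  obtain ⟨α, hα, hC⟩ := hT' ⟨t₀, ht₀⟩
  exact integratedBoundAt_of_cardyMod ⟨t₀, ht₀⟩ α hα hC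
    (fun Q hQ e he => hB₁ Q hQ t₀ ht₀ e he) R ε hε

/-! ## The restated crux is the line's stub (B₁) -/

/-- **The crux restricted to rectilinear conformal rectangles is stub (B₁).** Uniform marginality over
rectilinear conformal rectangles in the route's form (parameters in `unitInterval`, `dist`,
`P = cornerCrossingProb`) is equivalent to the registered stub `stub_integratedBoundRectilinear` of the line
(real parameters in `[0,1]`, `Pext`; `Pext R δ t = cornerCrossingProb t R δ`, `Pext_coe`). -/
theorem uniformMarginalityRect_iff_integratedBoundRectilinear :
    (∀ (t₀ : unitInterval) (R : ConformalRectangle),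
      (∃ S : Finset (ℂ × ℂ), (∀ p ∈ S, p.1.re = p.2.re ∨ p.1.im = p.2.im) ∧
        frontier R.carrier ⊆ ⋃ p ∈ S, segment ℝ p.1 p.2) →
      ∀ ε : ℝ, 0 < ε → ∃ η > 0, ∀ t : unitInterval, dist t t₀ < η → ∀ δ : ℝ, 0 < δ →
        |Literature.Probability.Percolation.cornerCrossingProb t R δ -
          Literature.Probability.Percolation.cornerCrossingProb t₀ R δ| < ε) ↔
    (∀ R : ConformalRectangle,
      (∃ S : Finset (ℂ × ℂ), (∀ p ∈ S, p.1.re = p.2.re ∨ p.1.im = p.2.im) ∧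
        frontier R.carrier ⊆ ⋃ p ∈ S, segment ℝ p.1 p.2) →
      ∀ t₀ : ℝ, t₀ ∈ Set.Icc (0 : ℝ) 1 → ∀ ε > 0, ∃ η > 0,
        ∀ δ : ℝ, 0 < δ → ∀ t ∈ Set.Icc (0 : ℝ) 1, |t - t₀| < η → |Pext R δ t - Pext R δ t₀| < ε) := by
  constructor
  · intro h R hR t₀ ht₀ ε hε
    obtain ⟨η, hη, hmain⟩ := h ⟨t₀, ht₀⟩ R hR ε hε
    refine ⟨η, hη, fun δ hδ t ht htt₀ => ?_⟩
    have key := hmain ⟨t, ht⟩ (by rw [Subtype.dist_eq, Real.dist_eq]; exact htt₀) δ hδ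
    rw [← Pext_coe R δ ⟨t, ht⟩, ← Pext_coe R δ ⟨t₀, ht₀⟩] at key
    exact key
  · intro h t₀ R hR ε hε
    obtain ⟨η, hη, hmain⟩ := h R hR (t₀ : ℝ) t₀.2 ε hε
    refine ⟨η, hη, fun t ht δ hδ => ?_⟩
    have key := hmain δ hδ (t : ℝ) t.2 (by rw [← Real.dist_eq, ← Subtype.dist_eq]; exact ht)
    rw [Pext_coe, Pext_coe] at key
    exact key

end Summit.CriticalPhenomena.CardyFormulaZ2.Cruxes.UniformMarginality.HeatFlow

end
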